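import Summits.QuantumFields.YangMills.Theorems.UnitScaleTiltProp7SectET3CombLettersT3
import Summits.QuantumFields.YangMills.Theorems.UnitScaleTiltProp7DeltaEtaAlmostPositive
import HarnessLib

/-!
# Route `UnitScaleTilt`, crux K1 «MinimiserStabilityRegPr» (stmt-QuantumFields-19200), LANE II «DIVERGENCE RECOVERY AT CURVED `W`», row (QH1)♮:
# **THE SECTOR SPLIT — `hQH1` FOR EVERY `M₂(ℂ)`-VALUED ONE-FORM FOLLOWS FROM `hQH1` ON THE 𝔰𝔲(2)-VALUED ONE-FORMS AND `hQH1` ON THE CENTRAL ONE-FORMS**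

Cell `ym3-torus`, width seat `ym3-torus-px21` (gen 8; offer (QH1-ii) of 2026-08-29 11:45Z, LOCATE `LOCATE-QH1-SECTORS-px21g8.md` ea3b0d6b75d161ee; px22 g6 LOCATE v4 §4 REMAINS (ii)).
THEOREMS ONLY (0 `def`, 0 `sorry`); `--supports stmt-QuantumFields-19200 --as helper`, count-neutral.  YM₃ on T³ is a ladder rung (R3), not d = 4, not infinite volume, not the
Clay problem; nothing here claims the stub, the crux, `hN06`, (QH1), (QB) or the mass gap.

THE POINT.  The displayed row `hQH1` of ✓`Prop7DivRecoveryMemberCorePackaged.member_core_row_packaged` (= the EX display S33ᴸ, binder `hQH1`) bounds the `Q_k^c`-mass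
`(c₀∕cB)·ℓ³·‖Qkc W f‖²` by `B‖f‖² + B′·H f + B″·e·‖f‖²` for EVERY `f : BondL2K` — every `M₂(ℂ)`-valued fine one-form `A` (`f = toL2 A`).  Its two suppliers in the tree speak of
SECTORS only: the leg lemma ✓`Prop7LegLemmaQTw.QTw_apply_eq_trueLinIter_sub_coarseGauge_T3` needs `A b ∈ 𝔰𝔲(2)` (`hA : A b ∈ skewAdjoint`, `htr : tr (A b) = 0`), and the central
identities ✓`Prop7QTwCentralSectorRegPr.QTw_smul_one_eq_QTw_one_of_regPr` treat `A = τ•1`.  Pointwise `M₂(ℂ) = 𝔰𝔲(2) ⊕ I•𝔰𝔲(2) ⊕ ℂ•1`: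
`A b = S b + I•T b + τ b•1` with `τ b := tr(A b)∕2`, `S b`, `T b` skew-Hermitian and traceless (§1).  In the hQH1 DIRECTION the averaging `Qkc W` sits on the MINORISING side, so
ℂ-linearity alone gives `‖Qkc (f_S + I•f_T + f_c)‖² ≤ 3(‖Qkc f_S‖² + ‖Qkc f_T‖² + ‖Qkc f_c‖²)` — no row about the sector image of `QTw W` is needed; the right-hand side needs
(M) `‖f‖² = ‖f_S‖² + ‖f_T‖² + ‖f_c‖²` (the three sectors are Hilbert–Schmidt orthogonal under print's pairing (3.11), ✓`inner_toL2`) and (H) `H f_S + H f_T + H f_c ≤ H f` for the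
free letter `H` — displayed here as the hypothesis `hHsplit` (discharged for the door's `H := c₀L·ℓ²·CURL_HS + ‖D*_W ·‖²` in the sibling file `…QH1SectorRowsOfH`).

WHAT IS PROVED (ns `…Theorems.Prop7QH1OfSectors`):
* §1 pointwise algebra on `M₂(ℂ)`: `skewPart_mem_skewAdjoint`∕`trace_skewPart`, `hermPartI_mem_skewAdjoint`∕`trace_hermPartI`, `sector_decomp`, `im_trace_conjTranspose_mul_eq_zero`
  (`tr(SᴴT) ∈ ℝ` for skew-Hermitian `S T`), `trace_conjTranspose_mul_smul_one` (`tr(Sᴴ(τ•1)) = 0` for traceless `S`).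
* §2 the `L²` rows: `re_inner_toL2_skew_smulI_eq_zero`, `inner_toL2_smul_one_eq_zero_of_traceless`, ★`normSq_toL2_sector_split` (M), `normSq_Qkc_sector_le_three`.
* §3 ★★★ `hQH1_of_sectors (H) (hH0) (hHsplit) (h𝔰𝔲) (hcen) : ⟨hQH1 VERBATIM⟩`, constants `(3(B₁+B₂), 3(B′₁+B′₂), 3(B″₁+B″₂), min eQ₁ eQ₂)`.
HONEST SCOPE.  Linear algebra and bookkeeping; the 𝔰𝔲(2) row `h𝔰𝔲`, the central row `hcen` and `hHsplit` are DISPLAYED, not proved; nothing of [Balaban1985BackgroundPropagators] §3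
is asserted beyond the cited identification of the pairing.

References: T. Bałaban, CMP **99** (1985) 389–434 [Balaban1985BackgroundPropagators] (p.391 «X·Y = tr XY», (3.11) p.392, (3.14) p.393, (3.19)–(3.26) pp.393–395);
CMP **102** (1985) 277–309 [Balaban1985Variational] ((44)–(45) p.285, (51) p.286); CMP **98** (1985) 17–51 [Balaban1985Averaging] ((18)–(19) p.21).
-/

set_option autoImplicit false

noncomputable section

open scoped BigOperators Matrix.Norms.L2Operator Matrix InnerProductSpace ComplexConjugate

namespace Summit.QuantumFields.YangMills.Theorems.Prop7QH1OfSectors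

open Literature.MathematicalPhysics.QuantumFieldTheory.Balaban1983to89
open Literature.MathematicalPhysics.QuantumFieldTheory.Balaban1983to89.T3ContinuumYM3Torus
open Literature.MathematicalPhysics.QuantumFieldTheory.Balaban1983to89.T3PrintedRegularMinimiser (RegPr)
open B11Eq103H1Complex (BondL2K)
open Summit.QuantumFields.YangMills.Theorems.Prop7SectET3Transport (periodsT3)
open Summit.QuantumFields.YangMills.Theorems.Prop7SectET3HilbertLetters (W₂ frobEquiv toL2 inner_toL2)
open Summit.QuantumFields.YangMills.Theorems.Prop7SectET3CombLetters (Qkc)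

/-! ## §1 Pointwise algebra: `M₂(ℂ) = 𝔰𝔲(2) ⊕ I•𝔰𝔲(2) ⊕ ℂ•1` -/

section Pointwise

/-- The skew part `½(A₀ − A₀ᴴ)` of the traceless part `A₀ := A − (tr A∕2)•1` is skew-adjoint. [cite: Balaban1985Averaging, (18)–(19) p.21] -/
theorem skewPart_mem_skewAdjoint (A : Matrix (Fin 2) (Fin 2) ℂ) :
    (1 / 2 : ℂ) • ((A - (A.trace / 2) • (1 : Matrix (Fin 2) (Fin 2) ℂ)) - (A - (A.trace / 2) • (1 : Matrix (Fin 2) (Fin 2) ℂ))ᴴ)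
      ∈ skewAdjoint (Matrix (Fin 2) (Fin 2) ℂ) := by
  rw [skewAdjoint.mem_iff, Matrix.star_eq_conjTranspose, Matrix.conjTranspose_smul, Matrix.conjTranspose_sub, Matrix.conjTranspose_conjTranspose]
  have h12 : star (1 / 2 : ℂ) = 1 / 2 := by
    rw [Complex.star_def, map_div₀, map_one, map_ofNat]
  rw [h12, ← smul_neg, neg_sub]

/-- The skew part of the traceless part is traceless. [cite: Balaban1985Averaging, (18)–(19) p.21] -/
theorem trace_skewPart (A : Matrix (Fin 2) (Fin 2) ℂ) :
    ((1 / 2 : ℂ) • ((A - (A.trace / 2) • (1 : Matrix (Fin 2) (Fin 2) ℂ)) - (A - (A.trace / 2) • (1 : Matrix (Fin 2) (Fin 2) ℂ))ᴴ)).trace = 0 := by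
  have h0 : (A - (A.trace / 2) • (1 : Matrix (Fin 2) (Fin 2) ℂ)).trace = 0 := by
    rw [Matrix.trace_sub, Matrix.trace_smul, Matrix.trace_one, Fintype.card_fin, smul_eq_mul]
    push_cast
    ring
  rw [Matrix.trace_smul, Matrix.trace_sub, Matrix.trace_conjTranspose, h0, star_zero, sub_zero, smul_zero]

/-- `−(I∕2)•(A₀ + A₀ᴴ)` (the Hermitian part of the traceless part, turned into `𝔰𝔲(2)` by the factor `−I`) is skew-adjoint. [cite: Balaban1985Averaging, (18)–(19) p.21] -/
theorem hermPartI_mem_skewAdjoint (A : Matrix (Fin 2) (Fin 2) ℂ) :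
    (-(Complex.I / 2)) • ((A - (A.trace / 2) • (1 : Matrix (Fin 2) (Fin 2) ℂ)) + (A - (A.trace / 2) • (1 : Matrix (Fin 2) (Fin 2) ℂ))ᴴ)
      ∈ skewAdjoint (Matrix (Fin 2) (Fin 2) ℂ) := by
  rw [skewAdjoint.mem_iff, Matrix.star_eq_conjTranspose, Matrix.conjTranspose_smul, Matrix.conjTranspose_add, Matrix.conjTranspose_conjTranspose]
  have hI : star (-(Complex.I / 2)) = Complex.I / 2 := by
    rw [Complex.star_def, map_neg, map_div₀, Complex.conj_I, map_ofNat, neg_div, neg_neg]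
  rw [hI, ← neg_smul, neg_neg, add_comm]

/-- `−(I∕2)•(A₀ + A₀ᴴ)` is traceless. [cite: Balaban1985Averaging, (18)–(19) p.21] -/
theorem trace_hermPartI (A : Matrix (Fin 2) (Fin 2) ℂ) :
    ((-(Complex.I / 2)) • ((A - (A.trace / 2) • (1 : Matrix (Fin 2) (Fin 2) ℂ)) + (A - (A.trace / 2) • (1 : Matrix (Fin 2) (Fin 2) ℂ))ᴴ)).trace = 0 := by
  have h0 : (A - (A.trace / 2) • (1 : Matrix (Fin 2) (Fin 2) ℂ)).trace = 0 := by
    rw [Matrix.trace_sub, Matrix.trace_smul, Matrix.trace_one, Fintype.card_fin, smul_eq_mul]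
    push_cast
    ring
  rw [Matrix.trace_smul, Matrix.trace_add, Matrix.trace_conjTranspose, h0, star_zero, add_zero, smul_zero]

/-- ★ **THE SECTOR DECOMPOSITION `A = S + I•T + (tr A∕2)•1`** with `S := ½(A₀ − A₀ᴴ)`, `T := −(I∕2)(A₀ + A₀ᴴ)`, `A₀ := A − (tr A∕2)•1`.
[cite: Balaban1985Averaging, (18)–(19) p.21] -/
theorem sector_decomp (A : Matrix (Fin 2) (Fin 2) ℂ) :
    A = (1 / 2 : ℂ) • ((A - (A.trace / 2) • (1 : Matrix (Fin 2) (Fin 2) ℂ)) - (A - (A.trace / 2) • (1 : Matrix (Fin 2) (Fin 2) ℂ))ᴴ)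
        + Complex.I • ((-(Complex.I / 2)) • ((A - (A.trace / 2) • (1 : Matrix (Fin 2) (Fin 2) ℂ)) + (A - (A.trace / 2) • (1 : Matrix (Fin 2) (Fin 2) ℂ))ᴴ))
        + (A.trace / 2) • (1 : Matrix (Fin 2) (Fin 2) ℂ) := by
  rw [smul_smul]
  have hI : Complex.I * -(Complex.I / 2) = 1 / 2 := by
    rw [mul_neg, mul_div_assoc', Complex.I_mul_I]
    ring
  rw [hI]
  set A₀ : Matrix (Fin 2) (Fin 2) ℂ := A - (A.trace / 2) • (1 : Matrix (Fin 2) (Fin 2) ℂ) with hA₀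
  have hsum : (1 / 2 : ℂ) • (A₀ - A₀ᴴ) + (1 / 2 : ℂ) • (A₀ + A₀ᴴ) = A₀ := by
    rw [← smul_add, sub_add_add_cancel, ← two_smul ℂ A₀, smul_smul]
    norm_num
  rw [hsum, hA₀, sub_add_cancel]

/-- **`tr(Sᴴ T)` IS REAL FOR SKEW-ADJOINT `S`, `T`**: `conj tr(SᴴT) = tr(TᴴS) = tr((−T)·S) = tr(S·(−T))… = tr(SᴴT)`. [cite: Balaban1985BackgroundPropagators, p.391] -/
theorem im_trace_conjTranspose_mul_eq_zero {S T : Matrix (Fin 2) (Fin 2) ℂ}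
    (hS : S ∈ skewAdjoint (Matrix (Fin 2) (Fin 2) ℂ)) (hT : T ∈ skewAdjoint (Matrix (Fin 2) (Fin 2) ℂ)) :
    ((Sᴴ * T).trace).im = 0 := by
  rw [skewAdjoint.mem_iff, Matrix.star_eq_conjTranspose] at hS hT
  have hstar : star ((Sᴴ * T).trace) = (Sᴴ * T).trace := by
    rw [← Matrix.trace_conjTranspose, Matrix.conjTranspose_mul, Matrix.conjTranspose_conjTranspose, hT, hS,
      Matrix.trace_mul_comm, neg_mul, mul_neg]
  have hconj : conj ((Sᴴ * T).trace) = (Sᴴ * T).trace := by rw [starRingEnd_apply]; exact hstar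
  exact Complex.conj_eq_iff_im.1 hconj

/-- **`tr(Sᴴ (τ•1)) = 0` FOR TRACELESS `S`**. [cite: Balaban1985BackgroundPropagators, p.391] -/
theorem trace_conjTranspose_mul_smul_one {S : Matrix (Fin 2) (Fin 2) ℂ} (hS0 : S.trace = 0) (τ : ℂ) :
    (Sᴴ * (τ • (1 : Matrix (Fin 2) (Fin 2) ℂ))).trace = 0 := by
  rw [Matrix.mul_smul, Matrix.mul_one, Matrix.trace_smul, Matrix.trace_conjTranspose, hS0, star_zero, smul_zero]

/-- **`tr((τ•1)ᴴ S) = 0` FOR TRACELESS `S`**. [cite: Balaban1985BackgroundPropagators, p.391] -/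
theorem trace_conjTranspose_smul_one_mul {S : Matrix (Fin 2) (Fin 2) ℂ} (hS0 : S.trace = 0) (τ : ℂ) :
    ((τ • (1 : Matrix (Fin 2) (Fin 2) ℂ))ᴴ * S).trace = 0 := by
  rw [Matrix.conjTranspose_smul, Matrix.conjTranspose_one, Matrix.smul_mul, Matrix.one_mul, Matrix.trace_smul, hS0, smul_zero]

end Pointwise

/-! ## §2 The three sectors are orthogonal in print's `L²` pairing (3.11); the crude `×3` on the ℂ-linear averaging `Qkc W` -/

section L2

variable {F : T3Family} {K : ℕ} {c₀ : ℝ} [Fact (0 < c₀)]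

/-- **`re⟪toL2 S, I • toL2 T⟫ = 0` FOR SKEW-ADJOINT-VALUED `S`, `T`** (`⟪S̃, T̃⟫ = c₀Σ tr(SᴴT)` is real, so `re(I·real) = 0`). [cite: Balaban1985BackgroundPropagators, (3.11) p.392] -/
theorem re_inner_toL2_skew_smulI_eq_zero {S T : PBond (F.P K) 0 → Matrix (Fin 2) (Fin 2) ℂ}
    (hS : ∀ b, S b ∈ skewAdjoint (Matrix (Fin 2) (Fin 2) ℂ)) (hT : ∀ b, T b ∈ skewAdjoint (Matrix (Fin 2) (Fin 2) ℂ)) :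
    RCLike.re ⟪toL2 F K c₀ S, Complex.I • toL2 F K c₀ T⟫_ℂ = 0 := by
  rw [inner_smul_right, inner_toL2]
  have him : (∑ b : PBond (F.P K) 0, ((S b)ᴴ * T b).trace).im = 0 := by
    rw [Complex.im_sum]
    exact Finset.sum_eq_zero fun b _ => im_trace_conjTranspose_mul_eq_zero (hS b) (hT b)
  rw [RCLike.re_to_complex, Complex.mul_re, Complex.I_re, Complex.I_im, zero_mul, one_mul, zero_sub, Complex.mul_im, Complex.ofReal_re,
    Complex.ofReal_im, zero_mul, add_zero, him, mul_zero, neg_zero]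

/-- **`⟪toL2 S, toL2 (τ•1)⟫ = 0` FOR TRACELESS-VALUED `S`** (central ⟂ traceless). [cite: Balaban1985BackgroundPropagators, (3.11) p.392] -/
theorem inner_toL2_smul_one_eq_zero_of_traceless {S : PBond (F.P K) 0 → Matrix (Fin 2) (Fin 2) ℂ} (hS0 : ∀ b, (S b).trace = 0)
    (τ : PBond (F.P K) 0 → ℂ) :
    ⟪toL2 F K c₀ S, toL2 F K c₀ (fun b => τ b • (1 : Matrix (Fin 2) (Fin 2) ℂ))⟫_ℂ = 0 := by
  rw [inner_toL2, Finset.sum_eq_zero fun b _ => trace_conjTranspose_mul_smul_one (hS0 b) (τ b), mul_zero]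

/-- **`⟪toL2 (τ•1), toL2 S⟫ = 0` FOR TRACELESS-VALUED `S`**. [cite: Balaban1985BackgroundPropagators, (3.11) p.392] -/
theorem inner_toL2_smul_one_left_eq_zero_of_traceless {S : PBond (F.P K) 0 → Matrix (Fin 2) (Fin 2) ℂ} (hS0 : ∀ b, (S b).trace = 0)
    (τ : PBond (F.P K) 0 → ℂ) :
    ⟪toL2 F K c₀ (fun b => τ b • (1 : Matrix (Fin 2) (Fin 2) ℂ)), toL2 F K c₀ S⟫_ℂ = 0 := by
  rw [inner_toL2, Finset.sum_eq_zero fun b _ => trace_conjTranspose_smul_one_mul (hS0 b) (τ b), mul_zero]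

/-- ★ **(M) THE MASS SPLITS OVER THE THREE SECTORS**: for skew-adjoint traceless `S T` and scalars `τ`,
`‖toL2 (S + I•T + τ•1)‖² = ‖toL2 S‖² + ‖toL2 T‖² + ‖toL2 (τ•1)‖²`. [cite: Balaban1985BackgroundPropagators, (3.11) p.392; Balaban1985Averaging, (18) p.21] -/
theorem normSq_toL2_sector_split {S T : PBond (F.P K) 0 → Matrix (Fin 2) (Fin 2) ℂ} (τ : PBond (F.P K) 0 → ℂ)
    (hS : ∀ b, S b ∈ skewAdjoint (Matrix (Fin 2) (Fin 2) ℂ)) (hS0 : ∀ b, (S b).trace = 0)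
    (hT : ∀ b, T b ∈ skewAdjoint (Matrix (Fin 2) (Fin 2) ℂ)) (hT0 : ∀ b, (T b).trace = 0) :
    ‖toL2 F K c₀ (fun b => S b + Complex.I • T b + τ b • (1 : Matrix (Fin 2) (Fin 2) ℂ))‖ ^ 2
      = ‖toL2 F K c₀ S‖ ^ 2 + ‖toL2 F K c₀ T‖ ^ 2 + ‖toL2 F K c₀ (fun b => τ b • (1 : Matrix (Fin 2) (Fin 2) ℂ))‖ ^ 2 := by
  have hlin : toL2 F K c₀ (fun b => S b + Complex.I • T b + τ b • (1 : Matrix (Fin 2) (Fin 2) ℂ))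
      = toL2 F K c₀ S + Complex.I • toL2 F K c₀ T + toL2 F K c₀ (fun b => τ b • (1 : Matrix (Fin 2) (Fin 2) ℂ)) := by
    rw [← map_smul, ← map_add, ← map_add]
    rfl
  have hIT0 : ∀ b, ((Complex.I • T) b).trace = 0 := fun b => by rw [Pi.smul_apply, Matrix.trace_smul, hT0, smul_zero]
  have hST0 : ∀ b, ((S + Complex.I • T) b).trace = 0 := fun b => by rw [Pi.add_apply, Matrix.trace_add, hS0, hIT0, add_zero]
  have h1 : RCLike.re ⟪toL2 F K c₀ S + Complex.I • toL2 F K c₀ T, toL2 F K c₀ (fun b => τ b • (1 : Matrix (Fin 2) (Fin 2) ℂ))⟫_ℂ = 0 := by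
    have : toL2 F K c₀ S + Complex.I • toL2 F K c₀ T = toL2 F K c₀ (S + Complex.I • T) := by rw [map_add, map_smul]
    rw [this, inner_toL2_smul_one_eq_zero_of_traceless hST0, map_zero]
  have h2 : RCLike.re ⟪toL2 F K c₀ S, Complex.I • toL2 F K c₀ T⟫_ℂ = 0 := re_inner_toL2_skew_smulI_eq_zero hS hT
  have hI : ‖Complex.I • toL2 F K c₀ T‖ = ‖toL2 F K c₀ T‖ := by rw [norm_smul, Complex.norm_I, one_mul]
  rw [hlin, @norm_add_sq ℂ, @norm_add_sq ℂ, h1, h2, hI]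
  ring

omit [Fact (0 < c₀)] in
/-- **THE CRUDE `×3` ON THE ℂ-LINEAR AVERAGING**: `‖Qkc W (toL2 (S + I•T + τ•1))‖² ≤ 3·(‖Qkc W (toL2 S)‖² + ‖Qkc W (toL2 T)‖² + ‖Qkc W (toL2 (τ•1))‖²)` — no hypothesis on `S T τ`.
[cite: Balaban1985BackgroundPropagators, (3.14) p.393; Balaban1985Variational, (44) p.285] -/
theorem normSq_Qkc_sector_le_three {n : ℕ} (h : n ≤ K) {cB : ℝ} [Fact (0 < cB)] (W : GaugeField (F.P K) 0 (Matrix.specialUnitaryGroup (Fin 2) ℂ))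
    (S T : PBond (F.P K) 0 → Matrix (Fin 2) (Fin 2) ℂ) (τ : PBond (F.P K) 0 → ℂ) :
    ‖Qkc F n K h c₀ cB W (toL2 F K c₀ (fun b => S b + Complex.I • T b + τ b • (1 : Matrix (Fin 2) (Fin 2) ℂ)))‖ ^ 2
      ≤ 3 * (‖Qkc F n K h c₀ cB W (toL2 F K c₀ S)‖ ^ 2 + ‖Qkc F n K h c₀ cB W (toL2 F K c₀ T)‖ ^ 2
          + ‖Qkc F n K h c₀ cB W (toL2 F K c₀ (fun b => τ b • (1 : Matrix (Fin 2) (Fin 2) ℂ)))‖ ^ 2) := by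
  have hlin : toL2 F K c₀ (fun b => S b + Complex.I • T b + τ b • (1 : Matrix (Fin 2) (Fin 2) ℂ))
      = toL2 F K c₀ S + Complex.I • toL2 F K c₀ T + toL2 F K c₀ (fun b => τ b • (1 : Matrix (Fin 2) (Fin 2) ℂ)) := by
    rw [← map_smul, ← map_add, ← map_add]
    rfl
  rw [hlin, map_add, map_add, map_smul]
  set x := Qkc F n K h c₀ cB W (toL2 F K c₀ S)
  set y := Qkc F n K h c₀ cB W (toL2 F K c₀ T)
  set z := Qkc F n K h c₀ cB W (toL2 F K c₀ (fun b => τ b • (1 : Matrix (Fin 2) (Fin 2) ℂ)))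
  have hI : ‖Complex.I • y‖ = ‖y‖ := by rw [norm_smul, Complex.norm_I, one_mul]
  have htri : ‖x + Complex.I • y + z‖ ≤ ‖x‖ + ‖y‖ + ‖z‖ := by
    calc ‖x + Complex.I • y + z‖ ≤ ‖x‖ + ‖Complex.I • y‖ + ‖z‖ := norm_add₃_le
      _ = ‖x‖ + ‖y‖ + ‖z‖ := by rw [hI]
  have h0 : 0 ≤ ‖x + Complex.I • y + z‖ := norm_nonneg _
  nlinarith [htri, h0, norm_nonneg x, norm_nonneg y, norm_nonneg z, sq_nonneg (‖x‖ - ‖y‖), sq_nonneg (‖y‖ - ‖z‖), sq_nonneg (‖x‖ - ‖z‖)]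

end L2

/-! ## §3 ★★★ `hQH1` for every one-form from the two sector rows -/

variable (c₀ cB : ℕ → ℝ) [hc₀ : ∀ L : ℕ, Fact (0 < c₀ L)] [hcB : ∀ L : ℕ, Fact (0 < cB L)]

set_option maxHeartbeats 400000 in
-- HEARTBEAT rule (README): three copies of the ~10-line (QH1) binder text in the statement + the final linear bookkeeping; measured close to the default budget, kept decl-local.
/-- ★★★ **(QH1-ii) THE SECTOR SPLIT.**  DISPLAYED: the free letter `H` with `hH0` (as in the EX display) and its sector sub-additivity `hHsplit`; the (QH1)♮ row on the 𝔰𝔲(2)-valued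
one-forms `h𝔰𝔲` (the leg lemma's `hA`∕`htr` class) and on the central one-forms `hcen`.  CONCLUSION: the `hQH1` binder of ✓`Prop7DivRecoveryMemberCorePackaged.member_core_row_packaged`
(= EX display S33ᴸ `hQH1`) TOKEN FOR TOKEN, for every `f : BondL2K`, with `(B, B′, B″, eQ) := (3(B₁+B₂), 3(B′₁+B′₂), 3(B″₁+B″₂), min eQ₁ eQ₂)`.
[cite: Balaban1985BackgroundPropagators, (3.11) p.392, (3.14) p.393, (3.19)–(3.26) pp.393–395; Balaban1985Variational, (44)–(45) p.285] -/
theorem hQH1_of_sectors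
    (H : ∀ (F : T3Family) (n K : ℕ) (W : GaugeField (F.P K) 0 (Matrix.specialUnitaryGroup (Fin 2) ℂ)), BondL2K ℂ 3 (periodsT3 F K) (c₀ F.L) W₂ → ℝ)
    (hH0 : ∀ F n K W f, 0 ≤ H F n K W f)
    (hHsplit : ∀ (F : T3Family) (n K : ℕ) (W : GaugeField (F.P K) 0 (Matrix.specialUnitaryGroup (Fin 2) ℂ))
      (S T : PBond (F.P K) 0 → Matrix (Fin 2) (Fin 2) ℂ) (τ : PBond (F.P K) 0 → ℂ),
      (∀ b, S b ∈ skewAdjoint (Matrix (Fin 2) (Fin 2) ℂ)) → (∀ b, (S b).trace = 0) →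
      (∀ b, T b ∈ skewAdjoint (Matrix (Fin 2) (Fin 2) ℂ)) → (∀ b, (T b).trace = 0) →
        H F n K W (toL2 F K (c₀ F.L) S) + H F n K W (toL2 F K (c₀ F.L) T) + H F n K W (toL2 F K (c₀ F.L) (fun b => τ b • (1 : Matrix (Fin 2) (Fin 2) ℂ)))
          ≤ H F n K W (toL2 F K (c₀ F.L) (fun b => S b + Complex.I • T b + τ b • (1 : Matrix (Fin 2) (Fin 2) ℂ))))
    (h𝔰𝔲 : ∀ (L : ℕ), 1 < L → ∃ B B' B'' eQ : ℝ, 0 ≤ B ∧ 0 ≤ B' ∧ 0 ≤ B'' ∧ 0 < eQ ∧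
      ∀ (F : T3Family), F.L = L → ∀ (n K : ℕ) (hnK : n < K) (e : ℝ) (W : GaugeField (F.P K) 0 (Matrix.specialUnitaryGroup (Fin 2) ℂ)),
        0 < e → e ≤ eQ → RegPr F n K e W →
        ∀ A : PBond (F.P K) 0 → Matrix (Fin 2) (Fin 2) ℂ, (∀ b, A b ∈ skewAdjoint (Matrix (Fin 2) (Fin 2) ℂ)) → (∀ b, (A b).trace = 0) →
          (c₀ F.L / cB F.L) * ((F.L : ℝ) ^ (K - n)) ^ 3 * ‖Qkc F n K hnK.le (c₀ F.L) (cB F.L) W (toL2 F K (c₀ F.L) A)‖ ^ 2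
            ≤ B * ‖toL2 F K (c₀ F.L) A‖ ^ 2 + B' * H F n K W (toL2 F K (c₀ F.L) A) + B'' * e * ‖toL2 F K (c₀ F.L) A‖ ^ 2)
    (hcen : ∀ (L : ℕ), 1 < L → ∃ B B' B'' eQ : ℝ, 0 ≤ B ∧ 0 ≤ B' ∧ 0 ≤ B'' ∧ 0 < eQ ∧
      ∀ (F : T3Family), F.L = L → ∀ (n K : ℕ) (hnK : n < K) (e : ℝ) (W : GaugeField (F.P K) 0 (Matrix.specialUnitaryGroup (Fin 2) ℂ)),
        0 < e → e ≤ eQ → RegPr F n K e W →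
        ∀ τ : PBond (F.P K) 0 → ℂ,
          (c₀ F.L / cB F.L) * ((F.L : ℝ) ^ (K - n)) ^ 3
              * ‖Qkc F n K hnK.le (c₀ F.L) (cB F.L) W (toL2 F K (c₀ F.L) (fun b => τ b • (1 : Matrix (Fin 2) (Fin 2) ℂ)))‖ ^ 2
            ≤ B * ‖toL2 F K (c₀ F.L) (fun b => τ b • (1 : Matrix (Fin 2) (Fin 2) ℂ))‖ ^ 2
              + B' * H F n K W (toL2 F K (c₀ F.L) (fun b => τ b • (1 : Matrix (Fin 2) (Fin 2) ℂ)))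
              + B'' * e * ‖toL2 F K (c₀ F.L) (fun b => τ b • (1 : Matrix (Fin 2) (Fin 2) ℂ))‖ ^ 2) :
    ∀ (L : ℕ), 1 < L → ∃ B B' B'' eQ : ℝ, 0 ≤ B ∧ 0 ≤ B' ∧ 0 ≤ B'' ∧ 0 < eQ ∧
      ∀ (F : T3Family), F.L = L → ∀ (n K : ℕ) (hnK : n < K) (e : ℝ) (W : GaugeField (F.P K) 0 (Matrix.specialUnitaryGroup (Fin 2) ℂ)),
        0 < e → e ≤ eQ → RegPr F n K e W →
        ∀ f : BondL2K ℂ 3 (periodsT3 F K) (c₀ F.L) W₂,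
          (c₀ F.L / cB F.L) * ((F.L : ℝ) ^ (K - n)) ^ 3 * ‖Qkc F n K hnK.le (c₀ F.L) (cB F.L) W f‖ ^ 2
            ≤ B * ‖f‖ ^ 2 + B' * H F n K W f + B'' * e * ‖f‖ ^ 2 := by
  intro L hL
  obtain ⟨B₁, B₁', B₁'', eQ₁, hB₁, hB₁', hB₁'', heQ₁, hrow₁⟩ := h𝔰𝔲 L hL
  obtain ⟨B₂, B₂', B₂'', eQ₂, hB₂, hB₂', hB₂'', heQ₂, hrow₂⟩ := hcen L hL
  refine ⟨3 * (B₁ + B₂), 3 * (B₁' + B₂'), 3 * (B₁'' + B₂''), min eQ₁ eQ₂, by positivity, by positivity, by positivity, lt_min heQ₁ heQ₂, ?_⟩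
  intro F hF n K hnK e W he heQ hreg f
  have he₁ : e ≤ eQ₁ := heQ.trans (min_le_left _ _)
  have he₂ : e ≤ eQ₂ := heQ.trans (min_le_right _ _)
  -- read `f` on the route carrier and split it into sectors
  set A : PBond (F.P K) 0 → Matrix (Fin 2) (Fin 2) ℂ := (toL2 F K (c₀ F.L)).symm f with hA_def
  set τ : PBond (F.P K) 0 → ℂ := fun b => (A b).trace / 2 with hτ_def
  set S : PBond (F.P K) 0 → Matrix (Fin 2) (Fin 2) ℂ :=
    fun b => (1 / 2 : ℂ) • ((A b - ((A b).trace / 2) • (1 : Matrix (Fin 2) (Fin 2) ℂ)) - (A b - ((A b).trace / 2) • (1 : Matrix (Fin 2) (Fin 2) ℂ))ᴴ) with hS_def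
  set T : PBond (F.P K) 0 → Matrix (Fin 2) (Fin 2) ℂ :=
    fun b => (-(Complex.I / 2)) • ((A b - ((A b).trace / 2) • (1 : Matrix (Fin 2) (Fin 2) ℂ)) + (A b - ((A b).trace / 2) • (1 : Matrix (Fin 2) (Fin 2) ℂ))ᴴ) with hT_def
  have hS : ∀ b, S b ∈ skewAdjoint (Matrix (Fin 2) (Fin 2) ℂ) := fun b => skewPart_mem_skewAdjoint (A b)
  have hS0 : ∀ b, (S b).trace = 0 := fun b => trace_skewPart (A b)
  have hT : ∀ b, T b ∈ skewAdjoint (Matrix (Fin 2) (Fin 2) ℂ) := fun b => hermPartI_mem_skewAdjoint (A b)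
  have hT0 : ∀ b, (T b).trace = 0 := fun b => trace_hermPartI (A b)
  have hdec : A = fun b => S b + Complex.I • T b + τ b • (1 : Matrix (Fin 2) (Fin 2) ℂ) := funext fun b => sector_decomp (A b)
  have hf : f = toL2 F K (c₀ F.L) (fun b => S b + Complex.I • T b + τ b • (1 : Matrix (Fin 2) (Fin 2) ℂ)) := by
    rw [← hdec, hA_def, LinearEquiv.apply_symm_apply]
  -- the three sector rows
  have h1 := hrow₁ F hF n K hnK e W he he₁ hreg S hS hS0
  have h2 := hrow₁ F hF n K hnK e W he he₁ hreg T hT hT0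
  have h3 := hrow₂ F hF n K hnK e W he he₂ hreg τ
  -- the split of the mass, the crude `×3`, the sub-additivity of `H`
  have hM := normSq_toL2_sector_split (F := F) (K := K) (c₀ := c₀ F.L) τ hS hS0 hT hT0
  have hQ := normSq_Qkc_sector_le_three (F := F) (K := K) (c₀ := c₀ F.L) hnK.le (cB := cB F.L) W S T τ
  have hHs := hHsplit F n K W S T τ hS hS0 hT hT0
  rw [hf, hM]
  -- bookkeeping letters
  set k : ℝ := (c₀ F.L / cB F.L) * ((F.L : ℝ) ^ (K - n)) ^ 3 with hk_def
  have hk : 0 ≤ k := by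
    have h₁ : 0 < c₀ F.L := (hc₀ F.L).out
    have h₂ : 0 < cB F.L := (hcB F.L).out
    positivity
  set qS := ‖Qkc F n K hnK.le (c₀ F.L) (cB F.L) W (toL2 F K (c₀ F.L) S)‖ ^ 2
  set qT := ‖Qkc F n K hnK.le (c₀ F.L) (cB F.L) W (toL2 F K (c₀ F.L) T)‖ ^ 2
  set qC := ‖Qkc F n K hnK.le (c₀ F.L) (cB F.L) W (toL2 F K (c₀ F.L) (fun b => τ b • (1 : Matrix (Fin 2) (Fin 2) ℂ)))‖ ^ 2
  set q := ‖Qkc F n K hnK.le (c₀ F.L) (cB F.L) W (toL2 F K (c₀ F.L) (fun b => S b + Complex.I • T b + τ b • (1 : Matrix (Fin 2) (Fin 2) ℂ)))‖ ^ 2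
  set xS := ‖toL2 F K (c₀ F.L) S‖ ^ 2
  set xT := ‖toL2 F K (c₀ F.L) T‖ ^ 2
  set xC := ‖toL2 F K (c₀ F.L) (fun b => τ b • (1 : Matrix (Fin 2) (Fin 2) ℂ))‖ ^ 2
  set HS := H F n K W (toL2 F K (c₀ F.L) S)
  set HT := H F n K W (toL2 F K (c₀ F.L) T)
  set HC := H F n K W (toL2 F K (c₀ F.L) (fun b => τ b • (1 : Matrix (Fin 2) (Fin 2) ℂ)))
  set Hf := H F n K W (toL2 F K (c₀ F.L) (fun b => S b + Complex.I • T b + τ b • (1 : Matrix (Fin 2) (Fin 2) ℂ)))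
  have hxS : 0 ≤ xS := by positivity
  have hxT : 0 ≤ xT := by positivity
  have hxC : 0 ≤ xC := by positivity
  have hHS : 0 ≤ HS := hH0 _ _ _ _ _
  have hHT : 0 ≤ HT := hH0 _ _ _ _ _
  have hHC : 0 ≤ HC := hH0 _ _ _ _ _
  have hkq : k * q ≤ 3 * (k * qS + k * qT + k * qC) := by
    have := mul_le_mul_of_nonneg_left hQ hk
    linarith
  have p1 : 0 ≤ B₂ * xS := mul_nonneg hB₂ hxS
  have p2 : 0 ≤ B₂ * xT := mul_nonneg hB₂ hxT
  have p3 : 0 ≤ B₁ * xC := mul_nonneg hB₁ hxC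
  have p4 : 0 ≤ B₂' * HS := mul_nonneg hB₂' hHS
  have p5 : 0 ≤ B₂' * HT := mul_nonneg hB₂' hHT
  have p6 : 0 ≤ B₁' * HC := mul_nonneg hB₁' hHC
  have p7 : 0 ≤ B₂'' * e * xS := mul_nonneg (mul_nonneg hB₂'' he.le) hxS
  have p8 : 0 ≤ B₂'' * e * xT := mul_nonneg (mul_nonneg hB₂'' he.le) hxT
  have p9 : 0 ≤ B₁'' * e * xC := mul_nonneg (mul_nonneg hB₁'' he.le) hxC
  have p10 : 0 ≤ (B₁' + B₂') * (Hf - (HS + HT + HC)) := mul_nonneg (add_nonneg hB₁' hB₂') (by linarith)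
  nlinarith [hkq, h1, h2, h3, p1, p2, p3, p4, p5, p6, p7, p8, p9, p10]

end Summit.QuantumFields.YangMills.Theorems.Prop7QH1OfSectors

end
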